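import Summits.RiemannHypothesis.RiemannHypothesis.Theorems.WeilWindowFlowWindowLipschitzStubCommutatorBoundAux
import Summits.RiemannHypothesis.RiemannHypothesis.Theorems.WeilWindowFlowWindowLipschitzStubSurplusReductionAux

/-!
# Edge law by cutting — one-dimensional kernel lemmas (RH-free)

Part of the pub-rhpf THEORY-2 programme (mechanism / rigidity of the Weil window bottom; no RH
claims). This file collects the one-dimensional calculus behind the SHARP commutator estimate of a
STEEP cut of a Weil ground state (ramp of width `ℓ` ending at depth `h + ℓ`, compare
`WeilWindowFlowWindowLipschitzStubCommutatorBound*`, where the ramp has width `h` and the constant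
is not tracked):

* `weilArchDensity_le_half_inv_add_one`: `ρ(t) ≤ 1/(2t) + 1` on `(0, 1]`;
* the near-jump coefficient `cutNearCoeff ℓ R t = 1_{(0,R]}(t) ρ(t) min(1, t²/ℓ²)` with
  `∫ cutNearCoeff ℓ R ≤ log((R + ℓ)/ℓ) + R` (`min(1, t²/ℓ²) ≤ 2t/(t + ℓ)`);
* `integral_inv_mul_sqrt_log`: `∫_R^{r₀} ds/(s √(log 1/s)) = 2(√(log 1/R) − √(log 1/r₀))`;
* the far weight `cutFarWeight s = √(log 1/s)/(2s)`, its negative derivative `cutFarWeightDeriv`,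
  the representation `cutFarWeight s = cutFarWeight r₀ + ∫_s^{r₀} cutFarWeightDeriv`, and
  `∫_R^{r₀} cutFarWeightDeriv σ · σ/log(1/σ) dσ` in closed form;
  (the layer-cake bound that uses them is `PfPersistenceEdgeLawCutLayerCake`).

Sources: E. Bombieri, *Remarks on Weil's quadratic functional in the theory of prime numbers I*,
Rend. Mat. Acc. Lincei (9) 11 (2000) §4 (the variational setting); H. Cycon, R. Froese, W. Kirsch,
B. Simon, *Schrödinger Operators* (1987) Thm 3.2 (IMS localisation).
-/

set_option linter.dupNamespace false

noncomputable section

open MeasureTheory Set Filter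
open scoped Topology ENNReal NNReal

namespace Summit.RiemannHypothesis.RiemannHypothesis.Theorems.PfPersistence

open Literature.NumberTheory.LFunctions
open Summit.RiemannHypothesis.RiemannHypothesis.Theorems.WeilWindowFlowWindowLipschitz

/-! ## The archimedean density -/

/-- `ρ(t) ≤ 1/(2t) + 1` for `0 < t ≤ 1` (`|ρ(t) − 1/(2t)| ≤ 1` there). [folklore] -/
theorem weilArchDensity_le_half_inv_add_one {t : ℝ} (ht0 : 0 < t) (ht1 : t ≤ 1) :
    weilArchDensity t ≤ 1 / (2 * t) + 1 := by
  have h := abs_weilArchDensity_sub_le ht0 ht1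
  rw [abs_le] at h
  linarith [h.2]

/-- `ρ` is non-increasing: `ρ(t) ≤ ρ(c)` for `0 < c ≤ t`. [folklore] -/
theorem weilArchDensity_le_of_le {c t : ℝ} (hc : 0 < c) (hct : c ≤ t) :
    weilArchDensity t ≤ weilArchDensity c :=
  weilArchDensity_antitoneOn (mem_Ioi.2 hc) (mem_Ioi.2 (hc.trans_le hct)) hct

/-! ## The near-jump coefficient of a steep cut -/

/-- The near-jump coefficient of the steep cut with ramp width `ℓ`, truncated at the near radius
`R`: `c(t) = 1_{(0,R]}(t) ρ(t) min(1, t²/ℓ²)`. [folklore] -/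
def cutNearCoeff (ℓ R t : ℝ) : ℝ :=
  (Ioc 0 R).indicator (fun t ↦ weilArchDensity t * min 1 (t ^ 2 / ℓ ^ 2)) t

/-- `c ≥ 0`. [folklore] -/
theorem cutNearCoeff_nonneg (ℓ R t : ℝ) : 0 ≤ cutNearCoeff ℓ R t :=
  indicator_nonneg (fun s hs ↦ mul_nonneg (weilArchDensity_pos hs.1).le
    (le_min zero_le_one (by positivity))) t

/-- `c` is measurable. [folklore] -/
theorem measurable_cutNearCoeff (ℓ R : ℝ) : Measurable (cutNearCoeff ℓ R) :=
  (measurable_weilArchDensity.mul (measurable_const.min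
    ((measurable_id.pow_const 2).div_const _))).indicator measurableSet_Ioc

/-- `min(1, t²/ℓ²) ≤ 2t/(t + ℓ)` for `t ≥ 0`, `ℓ > 0`. [folklore] -/
theorem min_one_sq_div_le {ℓ t : ℝ} (hℓ : 0 < ℓ) (ht : 0 ≤ t) :
    min 1 (t ^ 2 / ℓ ^ 2) ≤ 2 * t / (t + ℓ) := by
  have htl : 0 < t + ℓ := by positivity
  rcases le_total t ℓ with h | h
  · calc min 1 (t ^ 2 / ℓ ^ 2) ≤ t ^ 2 / ℓ ^ 2 := min_le_right _ _
      _ ≤ t / ℓ := by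
          rw [div_le_div_iff₀ (by positivity) hℓ]
          nlinarith [mul_nonneg (mul_nonneg ht hℓ.le) (sub_nonneg.2 h)]
      _ ≤ 2 * t / (t + ℓ) := by
          rw [div_le_div_iff₀ hℓ htl]
          nlinarith
  · calc min 1 (t ^ 2 / ℓ ^ 2) ≤ 1 := min_le_left _ _
      _ ≤ 2 * t / (t + ℓ) := by
          rw [le_div_iff₀ htl]
          linarith

/-- Pointwise majorant `c(t) ≤ 1_{(0,R]}(t) (1/(t + ℓ) + 1)` for `R ≤ 1`
(`ρ ≤ 1/(2t) + 1`, `min(1, t²/ℓ²) ≤ min(1, 2t/(t+ℓ))`). [folklore] -/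
theorem cutNearCoeff_le {ℓ R : ℝ} (hℓ : 0 < ℓ) (hR1 : R ≤ 1) (t : ℝ) :
    cutNearCoeff ℓ R t ≤ (Ioc 0 R).indicator (fun t ↦ 1 / (t + ℓ) + 1) t := by
  unfold cutNearCoeff
  by_cases ht : t ∈ Ioc 0 R
  · rw [indicator_of_mem ht, indicator_of_mem ht]
    have ht0 : 0 < t := ht.1
    have hρ := weilArchDensity_le_half_inv_add_one ht0 (ht.2.trans hR1)
    have hρ0 : 0 ≤ weilArchDensity t := (weilArchDensity_pos ht0).le
    have hm1 : min 1 (t ^ 2 / ℓ ^ 2) ≤ 1 := min_le_left _ _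
    have hm2 := min_one_sq_div_le hℓ ht0.le
    have hm0 : 0 ≤ min 1 (t ^ 2 / ℓ ^ 2) := le_min zero_le_one (by positivity)
    have htl : 0 < t + ℓ := by positivity
    calc weilArchDensity t * min 1 (t ^ 2 / ℓ ^ 2)
        ≤ (1 / (2 * t) + 1) * min 1 (t ^ 2 / ℓ ^ 2) := mul_le_mul_of_nonneg_right hρ hm0
      _ = 1 / (2 * t) * min 1 (t ^ 2 / ℓ ^ 2) + min 1 (t ^ 2 / ℓ ^ 2) := by ring
      _ ≤ 1 / (2 * t) * (2 * t / (t + ℓ)) + 1 :=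
          add_le_add (mul_le_mul_of_nonneg_left hm2 (by positivity)) hm1
      _ = 1 / (t + ℓ) + 1 := by field_simp
  · rw [indicator_of_notMem ht, indicator_of_notMem ht]

/-- `c` is integrable and `∫ c ≤ log((R + ℓ)/ℓ) + R` for `0 < ℓ`, `0 < R ≤ 1`. [folklore] -/
theorem integral_cutNearCoeff_le {ℓ R : ℝ} (hℓ : 0 < ℓ) (hR : 0 < R) (hR1 : R ≤ 1) :
    Integrable (cutNearCoeff ℓ R) ∧
      ∫ t, cutNearCoeff ℓ R t ≤ Real.log ((R + ℓ) / ℓ) + R := by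
  set G : ℝ → ℝ := fun t ↦ 1 / (t + ℓ) + 1 with hG
  have hGc : ContinuousOn G (Icc 0 R) := by
    refine ContinuousOn.add (ContinuousOn.div continuousOn_const (continuousOn_id.add
      continuousOn_const) fun t ht ↦ ?_) continuousOn_const
    have : (0 : ℝ) ≤ t := ht.1
    exact (add_pos_of_nonneg_of_pos this hℓ).ne'
  have hGi : IntegrableOn G (Ioc 0 R) :=
    (hGc.integrableOn_compact isCompact_Icc).mono_set Ioc_subset_Icc_self
  have hGind : Integrable ((Ioc 0 R).indicator G) := (integrable_indicator_iff measurableSet_Ioc).2 hGi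
  have hci : Integrable (cutNearCoeff ℓ R) :=
    hGind.mono' (measurable_cutNearCoeff ℓ R).aestronglyMeasurable
      (Eventually.of_forall fun t ↦ by
        rw [Real.norm_of_nonneg (cutNearCoeff_nonneg ℓ R t)]
        exact cutNearCoeff_le hℓ hR1 t)
  refine ⟨hci, ?_⟩
  have h1 : ∫ t, cutNearCoeff ℓ R t ≤ ∫ t, (Ioc 0 R).indicator G t :=
    integral_mono hci hGind (cutNearCoeff_le hℓ hR1)
  have h2 : ∫ t, (Ioc 0 R).indicator G t = ∫ t in (0 : ℝ)..R, G t := by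
    rw [integral_indicator measurableSet_Ioc, intervalIntegral.integral_of_le hR.le]
  have hi1 : IntervalIntegrable (fun t : ℝ ↦ 1 / (t + ℓ)) volume 0 R := by
    refine (ContinuousOn.div continuousOn_const (continuousOn_id.add continuousOn_const)
      fun t ht ↦ ?_).intervalIntegrable
    rw [uIcc_of_le hR.le] at ht
    have : (0 : ℝ) ≤ t := ht.1
    exact (add_pos_of_nonneg_of_pos this hℓ).ne'
  have hi2 : IntervalIntegrable (fun _ : ℝ ↦ (1 : ℝ)) volume 0 R := intervalIntegrable_const
  have h3 : ∫ t in (0 : ℝ)..R, G t = Real.log ((R + ℓ) / ℓ) + R := by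
    simp only [hG]
    rw [intervalIntegral.integral_add hi1 hi2, intervalIntegral.integral_const, smul_eq_mul,
      sub_zero, mul_one]
    have h4 : ∫ t in (0 : ℝ)..R, 1 / (t + ℓ) = ∫ t in (0 : ℝ)..R, (fun s : ℝ ↦ s⁻¹) (t + ℓ) := by
      simp [one_div]
    rw [h4, intervalIntegral.integral_comp_add_right (fun s : ℝ ↦ s⁻¹) ℓ, zero_add,
      integral_inv_of_pos hℓ (by positivity)]
  linarith [h1, h2, h3]

/-! ## `log(1/s)` calculus -/

/-- `log(1/s) = −log s`. [folklore] -/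
theorem log_one_div_eq_neg (s : ℝ) : Real.log (1 / s) = -Real.log s := by
  rw [one_div, Real.log_inv]

/-- `log(1/·)` is antitone on `(0, ∞)`: `log(1/t) ≤ log(1/s)` for `0 < s ≤ t`. [folklore] -/
theorem log_one_div_antitone {s t : ℝ} (hs : 0 < s) (hst : s ≤ t) :
    Real.log (1 / t) ≤ Real.log (1 / s) := by
  rw [log_one_div_eq_neg, log_one_div_eq_neg, neg_le_neg_iff]
  exact Real.log_le_log hs hst

/-- `HasDerivAt (log(1/·)) (−1/s) s` for `s ≠ 0`. [folklore] -/
theorem hasDerivAt_log_one_div {s : ℝ} (hs : s ≠ 0) :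
    HasDerivAt (fun s : ℝ ↦ Real.log (1 / s)) (-(1 / s)) s := by
  have h : (fun s : ℝ ↦ Real.log (1 / s)) = fun s ↦ -Real.log s := by
    funext s
    exact log_one_div_eq_neg s
  rw [h, one_div]
  exact (Real.hasDerivAt_log hs).neg

/-- `HasDerivAt (√(log(1/·))) (−1/(2 s √(log 1/s))) s` for `0 < s < 1`. [folklore] -/
theorem hasDerivAt_sqrt_log_one_div {s : ℝ} (hs0 : 0 < s) (hs1 : s < 1) :
    HasDerivAt (fun s : ℝ ↦ Real.sqrt (Real.log (1 / s)))
      (-(1 / (2 * s * Real.sqrt (Real.log (1 / s))))) s := by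
  have hL := stub_surplusReduction_log_pos hs0 hs1
  have h := (hasDerivAt_log_one_div hs0.ne').sqrt hL.ne'
  exact h.congr_deriv (by ring)

/-- `∫_R^{r₀} ds/(s √(log 1/s)) = 2(√(log 1/R) − √(log 1/r₀))` for `0 < R ≤ r₀ < 1`. [folklore] -/
theorem integral_inv_mul_sqrt_log {R r₀ : ℝ} (hR : 0 < R) (hRr : R ≤ r₀) (hr1 : r₀ < 1) :
    ∫ s in R..r₀, 1 / (s * Real.sqrt (Real.log (1 / s))) =
      2 * (Real.sqrt (Real.log (1 / R)) - Real.sqrt (Real.log (1 / r₀))) := by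
  have hIcc : ∀ s ∈ uIcc R r₀, 0 < s ∧ s < 1 := fun s hs ↦ by
    rw [uIcc_of_le hRr] at hs
    exact ⟨hR.trans_le hs.1, hs.2.trans_lt hr1⟩
  have hderiv : ∀ s ∈ uIcc R r₀, HasDerivAt (fun s : ℝ ↦ -2 * Real.sqrt (Real.log (1 / s)))
      (1 / (s * Real.sqrt (Real.log (1 / s)))) s := fun s hs ↦ by
    obtain ⟨hs0, hs1⟩ := hIcc s hs
    have h := (hasDerivAt_sqrt_log_one_div hs0 hs1).const_mul (-2)
    exact h.congr_deriv (by ring)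
  have hcont : ContinuousOn (fun s : ℝ ↦ 1 / (s * Real.sqrt (Real.log (1 / s)))) (uIcc R r₀) := by
    refine ContinuousOn.div continuousOn_const (continuousOn_id.mul
      ((continuousOn_const.div continuousOn_id fun s hs ↦ (hIcc s hs).1.ne').log
        (fun s hs ↦ (one_div_pos.2 (hIcc s hs).1).ne')).sqrt) fun s hs ↦ ?_
    obtain ⟨hs0, hs1⟩ := hIcc s hs
    exact (mul_pos hs0 (Real.sqrt_pos.2 (stub_surplusReduction_log_pos hs0 hs1))).ne'
  rw [intervalIntegral.integral_eq_sub_of_hasDerivAt hderiv (hcont.intervalIntegrable)]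
  ring

/-- For `0 ≤ d ≤ H < R ≤ s`: `1/(s − d) ≤ (R/(R − H))/s`. [folklore] -/
theorem inv_sub_le_ratio_div {d H R s : ℝ} (hd : 0 ≤ d) (hdH : d ≤ H) (hHR : H < R) (hRs : R ≤ s) :
    1 / (s - d) ≤ R / (R - H) / s := by
  have hs : 0 < s := by linarith
  have hsd : 0 < s - d := by linarith
  have hRH : 0 < R - H := by linarith
  rw [div_div, div_le_div_iff₀ hsd (by positivity)]
  nlinarith

/-! ## The far weight -/

/-- The far weight `g(s) = √(log 1/s)/(2s)` of the sharp cut estimate. [folklore] -/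
def cutFarWeight (s : ℝ) : ℝ := Real.sqrt (Real.log (1 / s)) / (2 * s)

/-- Its negative derivative `k(s) = √(log 1/s)/(2s²) + 1/(4 s² √(log 1/s))`. [folklore] -/
def cutFarWeightDeriv (s : ℝ) : ℝ :=
  Real.sqrt (Real.log (1 / s)) / (2 * s ^ 2) + 1 / (4 * s ^ 2 * Real.sqrt (Real.log (1 / s)))

/-- `g ≥ 0` on `(0, 1)`. [folklore] -/
theorem cutFarWeight_nonneg {s : ℝ} (hs0 : 0 < s) : 0 ≤ cutFarWeight s := by
  unfold cutFarWeight
  positivity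

/-- `k ≥ 0` on `(0, ∞)`. [folklore] -/
theorem cutFarWeightDeriv_nonneg {s : ℝ} (hs0 : 0 < s) : 0 ≤ cutFarWeightDeriv s := by
  unfold cutFarWeightDeriv
  positivity

/-- `g' = −k` on `(0, 1)`. [folklore] -/
theorem hasDerivAt_cutFarWeight {s : ℝ} (hs0 : 0 < s) (hs1 : s < 1) :
    HasDerivAt cutFarWeight (-cutFarWeightDeriv s) s := by
  have hL := stub_surplusReduction_log_pos hs0 hs1
  have hsq : 0 < Real.sqrt (Real.log (1 / s)) := Real.sqrt_pos.2 hL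
  have h1 := hasDerivAt_sqrt_log_one_div hs0 hs1
  have h2 : HasDerivAt (fun s : ℝ ↦ 2 * s) 2 s := by
    simpa using (hasDerivAt_id s).const_mul (2 : ℝ)
  have h := h1.div h2 (by positivity)
  have hs0' : s ≠ 0 := hs0.ne'
  have hsq' : Real.sqrt (Real.log (1 / s)) ≠ 0 := hsq.ne'
  refine h.congr_deriv ?_
  unfold cutFarWeightDeriv
  field_simp
  ring

/-- `k` is continuous on `(0, 1)`-subintervals `[R, r₀]`. [folklore] -/
theorem continuousOn_cutFarWeightDeriv {R r₀ : ℝ} (hR : 0 < R) (hr1 : r₀ < 1) :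
    ContinuousOn cutFarWeightDeriv (Icc R r₀) := by
  have hpos : ∀ s ∈ Icc R r₀, 0 < s ∧ s < 1 := fun s hs ↦ ⟨hR.trans_le hs.1, hs.2.trans_lt hr1⟩
  have hsqrt : ContinuousOn (fun s : ℝ ↦ Real.sqrt (Real.log (1 / s))) (Icc R r₀) :=
    ((continuousOn_const.div continuousOn_id fun s hs ↦ (hpos s hs).1.ne').log
      fun s hs ↦ (one_div_pos.2 (hpos s hs).1).ne').sqrt
  unfold cutFarWeightDeriv
  refine ContinuousOn.add (hsqrt.div (continuousOn_const.mul (continuousOn_id.pow 2))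
    fun s hs ↦ ?_) (continuousOn_const.div ((continuousOn_const.mul (continuousOn_id.pow 2)).mul
      hsqrt) fun s hs ↦ ?_)
  · have := (hpos s hs).1
    positivity
  · obtain ⟨hs0, hs1⟩ := hpos s hs
    have := Real.sqrt_pos.2 (stub_surplusReduction_log_pos hs0 hs1)
    positivity

/-- `g(s) = g(r₀) + ∫_s^{r₀} k` for `0 < s ≤ r₀ < 1` (fundamental theorem of calculus). [folklore] -/
theorem cutFarWeight_eq_add_integral {s r₀ : ℝ} (hs0 : 0 < s) (hsr : s ≤ r₀) (hr1 : r₀ < 1) :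
    cutFarWeight s = cutFarWeight r₀ + ∫ σ in s..r₀, cutFarWeightDeriv σ := by
  have hIcc : ∀ σ ∈ uIcc s r₀, 0 < σ ∧ σ < 1 := fun σ hσ ↦ by
    rw [uIcc_of_le hsr] at hσ
    exact ⟨hs0.trans_le hσ.1, hσ.2.trans_lt hr1⟩
  have hderiv : ∀ σ ∈ uIcc s r₀, HasDerivAt cutFarWeight (-cutFarWeightDeriv σ) σ :=
    fun σ hσ ↦ hasDerivAt_cutFarWeight (hIcc σ hσ).1 (hIcc σ hσ).2
  have hint : IntervalIntegrable cutFarWeightDeriv volume s r₀ :=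
    ((continuousOn_cutFarWeightDeriv hs0 hr1).mono (by rw [uIcc_of_le hsr])).intervalIntegrable
  have h := intervalIntegral.integral_eq_sub_of_hasDerivAt hderiv hint.neg
  rw [intervalIntegral.integral_neg] at h
  linarith

/-- The closed form `∫_R^{r₀} k(σ) σ/log(1/σ) dσ = (√L_R − √L_{r₀}) + (1/(2√L_{r₀}) − 1/(2√L_R))`,
`L_s = log(1/s)` (antiderivative `−√L + 1/(2√L)`). [folklore] -/
theorem integral_cutFarWeightDeriv_mul {R r₀ : ℝ} (hR : 0 < R) (hRr : R ≤ r₀) (hr1 : r₀ < 1) :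
    IntervalIntegrable (fun σ ↦ cutFarWeightDeriv σ * (σ / Real.log (1 / σ))) volume R r₀ ∧
    ∫ σ in R..r₀, cutFarWeightDeriv σ * (σ / Real.log (1 / σ)) =
      (Real.sqrt (Real.log (1 / R)) - Real.sqrt (Real.log (1 / r₀))) +
        (1 / (2 * Real.sqrt (Real.log (1 / r₀))) - 1 / (2 * Real.sqrt (Real.log (1 / R)))) := by
  have hIcc : ∀ σ ∈ uIcc R r₀, 0 < σ ∧ σ < 1 := fun σ hσ ↦ by
    rw [uIcc_of_le hRr] at hσ
    exact ⟨hR.trans_le hσ.1, hσ.2.trans_lt hr1⟩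
  -- the antiderivative `F(σ) = −√L + 1/(2√L)`
  have hderiv : ∀ σ ∈ uIcc R r₀, HasDerivAt
      (fun σ : ℝ ↦ -Real.sqrt (Real.log (1 / σ)) + 1 / (2 * Real.sqrt (Real.log (1 / σ))))
      (cutFarWeightDeriv σ * (σ / Real.log (1 / σ))) σ := fun σ hσ ↦ by
    obtain ⟨hs0, hs1⟩ := hIcc σ hσ
    have hL := stub_surplusReduction_log_pos hs0 hs1
    have hsq : 0 < Real.sqrt (Real.log (1 / σ)) := Real.sqrt_pos.2 hL
    have h1 := hasDerivAt_sqrt_log_one_div hs0 hs1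
    have h2 : HasDerivAt (fun σ : ℝ ↦ 2 * Real.sqrt (Real.log (1 / σ)))
        (2 * -(1 / (2 * σ * Real.sqrt (Real.log (1 / σ))))) σ := h1.const_mul 2
    have h3 := (hasDerivAt_const σ (1 : ℝ)).div h2 (by positivity)
    have h := h1.neg.add h3
    refine h.congr_deriv ?_
    unfold cutFarWeightDeriv
    have hsq2 : Real.sqrt (Real.log (1 / σ)) ^ 2 = Real.log (1 / σ) := Real.sq_sqrt hL.le
    set y : ℝ := Real.sqrt (Real.log (1 / σ)) with hy
    have hy0 : y ≠ 0 := hsq.ne'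
    have hs0' : σ ≠ 0 := hs0.ne'
    rw [← hsq2]
    field_simp
    ring
  have hcont : ContinuousOn (fun σ ↦ cutFarWeightDeriv σ * (σ / Real.log (1 / σ))) (uIcc R r₀) := by
    rw [uIcc_of_le hRr]
    refine (continuousOn_cutFarWeightDeriv hR hr1).mul (continuousOn_id.div
      ((continuousOn_const.div continuousOn_id fun s hs ↦ ?_).log fun s hs ↦ ?_) fun s hs ↦ ?_)
    · exact (hR.trans_le hs.1).ne'
    · exact (one_div_pos.2 (hR.trans_le hs.1)).ne'
    · exact (stub_surplusReduction_log_pos (hR.trans_le hs.1) (hs.2.trans_lt hr1)).ne'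
  refine ⟨hcont.intervalIntegrable, ?_⟩
  rw [intervalIntegral.integral_eq_sub_of_hasDerivAt hderiv hcont.intervalIntegrable]
  ring

/-- `k(σ) σ/log(1/σ) ≥ 0` on `(0,1)`. [folklore] -/
theorem cutFarWeightDeriv_mul_nonneg {σ : ℝ} (hs0 : 0 < σ) (hs1 : σ < 1) :
    0 ≤ cutFarWeightDeriv σ * (σ / Real.log (1 / σ)) :=
  mul_nonneg (cutFarWeightDeriv_nonneg hs0) (div_nonneg hs0.le (stub_surplusReduction_log_pos hs0 hs1).le)

end Summit.RiemannHypothesis.RiemannHypothesis.Theorems.PfPersistence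

end
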